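import Mathlib
import HarnessLib
import Summits.HubbardSuperconductivity.HubbardSuperconductivity.Theorems.KLProgrammeKLRegimeCountertermJacksonRemainderCertDefs

/-!
# Route `KLProgramme`, crux K3 — gen-8 ENGINE-FLOW child (stmt-HubbardSuperconductivity-20437), stub (C) `stub_twoLeg_curvature`:
# the EXACT one-variable chain rule to order four (Faà di Bruno) on an open chart, and the transport/graded bounds in `bellP` currency

Seat hubbard-kl-k3c3-p1 (g7).  For `g : ℝ → ℝ` of class `C⁴` and an inner function `α : ℝ → ℝ` of class `C⁴` on an OPEN set `U ∋ θ`
(the displaced polar angle of the (C1) certificate is smooth only near the base angle, for almost every displacement):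
* §1 `iteratedDeriv_comp_two/three/four_of_isOpen` — `∂²(g∘α) = g″(α)α′² + g′(α)α″`, `∂³ = g‴α′³ + 3g″α′α″ + g′α‴`,
  `∂⁴ = g⁗α′⁴ + 6g‴α′²α″ + g″(3α″² + 4α′α‴) + g′α⁗` at every point of `U`;
* §2 `abs_iteratedDeriv_comp_le_bellP` — `|∂ᵏ(g∘α)(θ)| ≤ Σ_{l=1}^{k} a_l·P_{k,l}(|α′(θ)|,…)` from `|g^{(l)}| ≤ a_l` (`1 ≤ k ≤ 4`);
  `abs_iteratedDeriv_comp_sub_le_bellP` — the TRANSPORT form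
  `|∂ᵏ(g∘α)(θ) − g^{(k)}(α θ)·α′(θ)ᵏ| ≤ Σ_{l<k} a_l·P_{k,l}` and hence `|∂ᵏ(g∘α)(θ) − g^{(k)}(t)| ≤ Σ_{l<k} a_l P_{k,l} + a_k|α′ᵏ − 1| + |g^{(k)}(α θ) − g^{(k)}(t)|`;
* §3 periodic profiles: `iteratedDeriv k g` is `2π`-periodic and `|g^{(k)}(x) − g^{(k)}(t)| ≤ a_{k+1}·|⟨x − t⟩|` (`⟨·⟩` the representative in `(−π, π]`).
Pure one-variable calculus; no definitions; nothing here asserts superconductivity.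
-/

noncomputable section

namespace Summit.HubbardSuperconductivity.HubbardSuperconductivity.Theorems.KLRegimeSplit

set_option linter.dupNamespace false -- summit = problem name (single-conjunct summit), D-0017

open Real Set Filter
open scoped Topology

/-! ## §1 Exact chain rule to order four on an open chart -/

section Chain

variable {g α : ℝ → ℝ} {U : Set ℝ} (hU : IsOpen U) (hg : ContDiff ℝ 4 g) (hα : ContDiffOn ℝ 4 α U)
include hU hg hα

omit hg in
/-- `α` is differentiable on `U`. -/
theorem differentiableAt_of_contDiffOn_isOpen {ϑ : ℝ} (hϑ : ϑ ∈ U) : DifferentiableAt ℝ α ϑ :=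
  (hα.differentiableOn (by norm_num)).differentiableAt (hU.mem_nhds hϑ)

omit hg in
/-- `iteratedDeriv j α` (`j ≤ 3`) is differentiable at points of `U`, with derivative `iteratedDeriv (j+1) α`. -/
theorem hasDerivAt_iteratedDeriv_inner {j : ℕ} (hj : j ≤ 3) {ϑ : ℝ} (hϑ : ϑ ∈ U) :
    HasDerivAt (iteratedDeriv j α) (iteratedDeriv (j + 1) α ϑ) ϑ := by
  have hdiffW : DifferentiableOn ℝ (iteratedDerivWithin j α U) U :=
    hα.differentiableOn_iteratedDerivWithin (by exact_mod_cast Nat.lt_of_le_of_lt hj (by norm_num)) hU.uniqueDiffOn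
  have heq : ∀ y ∈ U, iteratedDerivWithin j α U y = iteratedDeriv j α y := fun y hy => iteratedDerivWithin_of_isOpen hU hy
  have hdiff : DifferentiableAt ℝ (iteratedDeriv j α) ϑ := by
    have h1 : DifferentiableAt ℝ (iteratedDerivWithin j α U) ϑ := (hdiffW ϑ hϑ).differentiableAt (hU.mem_nhds hϑ)
    refine h1.congr_of_eventuallyEq ?_
    filter_upwards [hU.mem_nhds hϑ] with y hy using (heq y hy).symm
  have := hdiff.hasDerivAt
  rwa [← iteratedDeriv_succ] at this

/-- `iteratedDeriv j g` (`j ≤ 3`) composed with `α` has derivative `g^{(j+1)}(α ϑ)·α′(ϑ)` at points of `U`. -/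
theorem hasDerivAt_iteratedDeriv_outer_comp {j : ℕ} (hj : j ≤ 3) {ϑ : ℝ} (hϑ : ϑ ∈ U) :
    HasDerivAt (fun x => iteratedDeriv j g (α x)) (iteratedDeriv (j + 1) g (α ϑ) * deriv α ϑ) ϑ := by
  have hgd : DifferentiableAt ℝ (iteratedDeriv j g) (α ϑ) :=
    (hg.differentiable_iteratedDeriv j (by exact_mod_cast Nat.lt_of_le_of_lt hj (by norm_num))) _
  have h1 : HasDerivAt (iteratedDeriv j g) (iteratedDeriv (j + 1) g (α ϑ)) (α ϑ) := by
    rw [iteratedDeriv_succ]; exact hgd.hasDerivAt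
  exact h1.comp ϑ (differentiableAt_of_contDiffOn_isOpen hU hα hϑ).hasDerivAt

/-- **Order 1**: `∂(g∘α)(ϑ) = g′(α ϑ)·α′(ϑ)` on `U`. -/
theorem iteratedDeriv_comp_one_of_isOpen {ϑ : ℝ} (hϑ : ϑ ∈ U) :
    iteratedDeriv 1 (fun x => g (α x)) ϑ = iteratedDeriv 1 g (α ϑ) * iteratedDeriv 1 α ϑ := by
  have h := hasDerivAt_iteratedDeriv_outer_comp hU hg hα (j := 0) (by norm_num) hϑ
  simp only [iteratedDeriv_zero, zero_add, iteratedDeriv_one] at h ⊢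
  exact h.deriv

/-- **Order 2**: `∂²(g∘α)(ϑ) = g″(α ϑ)·α′(ϑ)² + g′(α ϑ)·α″(ϑ)` on `U`. -/
theorem iteratedDeriv_comp_two_of_isOpen {ϑ : ℝ} (hϑ : ϑ ∈ U) :
    iteratedDeriv 2 (fun x => g (α x)) ϑ =
      iteratedDeriv 2 g (α ϑ) * iteratedDeriv 1 α ϑ ^ 2 + iteratedDeriv 1 g (α ϑ) * iteratedDeriv 2 α ϑ := by
  -- the first derivative as a function near `ϑ`
  have hev : deriv (fun x => g (α x)) =ᶠ[𝓝 ϑ] fun x => iteratedDeriv 1 g (α x) * iteratedDeriv 1 α x := by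
    filter_upwards [hU.mem_nhds hϑ] with y hy
    rw [← iteratedDeriv_one]; exact iteratedDeriv_comp_one_of_isOpen hU hg hα hy
  have hF : HasDerivAt (fun x => iteratedDeriv 1 g (α x) * iteratedDeriv 1 α x)
      (iteratedDeriv 2 g (α ϑ) * deriv α ϑ * iteratedDeriv 1 α ϑ + iteratedDeriv 1 g (α ϑ) * iteratedDeriv 2 α ϑ) ϑ :=
    (hasDerivAt_iteratedDeriv_outer_comp hU hg hα (j := 1) (by norm_num) hϑ).mul
      (hasDerivAt_iteratedDeriv_inner hU hα (j := 1) (by norm_num) hϑ)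
  rw [iteratedDeriv_succ, iteratedDeriv_one, hev.deriv_eq, hF.deriv]
  simp only [iteratedDeriv_one]
  ring

/-- **Order 3**: `∂³(g∘α)(ϑ) = g‴α′³ + 3g″α′α″ + g′α‴` on `U`. -/
theorem iteratedDeriv_comp_three_of_isOpen {ϑ : ℝ} (hϑ : ϑ ∈ U) :
    iteratedDeriv 3 (fun x => g (α x)) ϑ =
      iteratedDeriv 3 g (α ϑ) * iteratedDeriv 1 α ϑ ^ 3 + 3 * iteratedDeriv 2 g (α ϑ) * iteratedDeriv 1 α ϑ * iteratedDeriv 2 α ϑ +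
        iteratedDeriv 1 g (α ϑ) * iteratedDeriv 3 α ϑ := by
  have hev : iteratedDeriv 2 (fun x => g (α x)) =ᶠ[𝓝 ϑ]
      fun x => iteratedDeriv 2 g (α x) * iteratedDeriv 1 α x ^ 2 + iteratedDeriv 1 g (α x) * iteratedDeriv 2 α x := by
    filter_upwards [hU.mem_nhds hϑ] with y hy using iteratedDeriv_comp_two_of_isOpen hU hg hα hy
  have h2g := hasDerivAt_iteratedDeriv_outer_comp hU hg hα (j := 2) (by norm_num) hϑ
  have h1g := hasDerivAt_iteratedDeriv_outer_comp hU hg hα (j := 1) (by norm_num) hϑ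
  have h1a := hasDerivAt_iteratedDeriv_inner hU hα (j := 1) (by norm_num) hϑ
  have h2a := hasDerivAt_iteratedDeriv_inner hU hα (j := 2) (by norm_num) hϑ
  have hF : HasDerivAt (fun x => iteratedDeriv 2 g (α x) * iteratedDeriv 1 α x ^ 2 + iteratedDeriv 1 g (α x) * iteratedDeriv 2 α x) _ ϑ :=
    (h2g.mul (h1a.pow 2)).add (h1g.mul h2a)
  rw [iteratedDeriv_succ, hev.deriv_eq, hF.deriv]
  simp only [Nat.cast_ofNat, iteratedDeriv_one, Pi.pow_apply]
  ring

/-- **Order 4**: `∂⁴(g∘α)(ϑ) = g⁗α′⁴ + 6g‴α′²α″ + g″(3α″² + 4α′α‴) + g′α⁗` on `U`. -/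
theorem iteratedDeriv_comp_four_of_isOpen {ϑ : ℝ} (hϑ : ϑ ∈ U) :
    iteratedDeriv 4 (fun x => g (α x)) ϑ =
      iteratedDeriv 4 g (α ϑ) * iteratedDeriv 1 α ϑ ^ 4 + 6 * iteratedDeriv 3 g (α ϑ) * iteratedDeriv 1 α ϑ ^ 2 * iteratedDeriv 2 α ϑ +
        iteratedDeriv 2 g (α ϑ) * (3 * iteratedDeriv 2 α ϑ ^ 2 + 4 * iteratedDeriv 1 α ϑ * iteratedDeriv 3 α ϑ) +
        iteratedDeriv 1 g (α ϑ) * iteratedDeriv 4 α ϑ := by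
  have hev : iteratedDeriv 3 (fun x => g (α x)) =ᶠ[𝓝 ϑ]
      fun x => iteratedDeriv 3 g (α x) * iteratedDeriv 1 α x ^ 3 + 3 * iteratedDeriv 2 g (α x) * iteratedDeriv 1 α x * iteratedDeriv 2 α x +
        iteratedDeriv 1 g (α x) * iteratedDeriv 3 α x := by
    filter_upwards [hU.mem_nhds hϑ] with y hy using iteratedDeriv_comp_three_of_isOpen hU hg hα hy
  have h3g := hasDerivAt_iteratedDeriv_outer_comp hU hg hα (j := 3) (by norm_num) hϑ
  have h2g := hasDerivAt_iteratedDeriv_outer_comp hU hg hα (j := 2) (by norm_num) hϑ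
  have h1g := hasDerivAt_iteratedDeriv_outer_comp hU hg hα (j := 1) (by norm_num) hϑ
  have h1a := hasDerivAt_iteratedDeriv_inner hU hα (j := 1) (by norm_num) hϑ
  have h2a := hasDerivAt_iteratedDeriv_inner hU hα (j := 2) (by norm_num) hϑ
  have h3a := hasDerivAt_iteratedDeriv_inner hU hα (j := 3) (by norm_num) hϑ
  have hF : HasDerivAt (fun x => iteratedDeriv 3 g (α x) * iteratedDeriv 1 α x ^ 3 + 3 * iteratedDeriv 2 g (α x) * iteratedDeriv 1 α x * iteratedDeriv 2 α x +
      iteratedDeriv 1 g (α x) * iteratedDeriv 3 α x) _ ϑ :=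
    ((h3g.mul (h1a.pow 3)).add (((h2g.const_mul 3).mul h1a).mul h2a)).add (h1g.mul h3a)
  rw [iteratedDeriv_succ, hev.deriv_eq, hF.deriv]
  simp only [Nat.cast_ofNat, iteratedDeriv_one, Pi.pow_apply, Pi.mul_apply]
  ring

end Chain

/-! ## §2 Bounds in `bellP` currency -/

section Bell

variable {g α : ℝ → ℝ} {U : Set ℝ} (hU : IsOpen U) (hg : ContDiff ℝ 4 g) (hα : ContDiffOn ℝ 4 α U) {θ : ℝ} (hθ : θ ∈ U)
  {a : ℕ → ℝ} (ha : ∀ l, 1 ≤ l → l ≤ 4 → ∀ x, |iteratedDeriv l g x| ≤ a l)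
include hU hg hα hθ ha

/-- **Transport form**: `|∂ᵏ(g∘α)(θ) − g^{(k)}(α θ)·α′(θ)ᵏ| ≤ Σ_{1 ≤ l < k} a_l·P_{k,l}(|α′(θ)|, |α″(θ)|, |α‴(θ)|, |α⁗(θ)|)` (`1 ≤ k ≤ 4`). -/
theorem abs_iteratedDeriv_comp_sub_le_bellP {k : ℕ} (hk1 : 1 ≤ k) (hk : k ≤ 4) :
    |iteratedDeriv k (fun x => g (α x)) θ - iteratedDeriv k g (α θ) * iteratedDeriv 1 α θ ^ k| ≤
      ∑ l ∈ Finset.Ico 1 k, a l * bellP k l (fun m => |iteratedDeriv m α θ|) := by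
  have a1 := ha 1 le_rfl (by norm_num) (α θ); have a2 := ha 2 (by norm_num) (by norm_num) (α θ)
  have a3 := ha 3 (by norm_num) (by norm_num) (α θ)
  set X1 := |iteratedDeriv 1 α θ|; set X2 := |iteratedDeriv 2 α θ|; set X3 := |iteratedDeriv 3 α θ|; set X4 := |iteratedDeriv 4 α θ|
  have hX1 : 0 ≤ X1 := abs_nonneg _; have hX2 : 0 ≤ X2 := abs_nonneg _; have hX3 : 0 ≤ X3 := abs_nonneg _; have hX4 : 0 ≤ X4 := abs_nonneg _
  interval_cases k
  · rw [iteratedDeriv_comp_one_of_isOpen hU hg hα hθ]; simp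
  · rw [iteratedDeriv_comp_two_of_isOpen hU hg hα hθ]
    have e : Finset.Ico 1 2 = {1} := by decide
    simp only [e, Finset.sum_singleton, bellP, add_sub_cancel_left, abs_mul]
    exact mul_le_mul_of_nonneg_right a1 (abs_nonneg _)
  · rw [iteratedDeriv_comp_three_of_isOpen hU hg hα hθ]
    have e : Finset.Ico 1 3 = {1, 2} := by decide
    simp only [e, Finset.sum_pair (show (1 : ℕ) ≠ 2 by norm_num), bellP]
    calc |iteratedDeriv 3 g (α θ) * iteratedDeriv 1 α θ ^ 3 + 3 * iteratedDeriv 2 g (α θ) * iteratedDeriv 1 α θ * iteratedDeriv 2 α θ +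
            iteratedDeriv 1 g (α θ) * iteratedDeriv 3 α θ - iteratedDeriv 3 g (α θ) * iteratedDeriv 1 α θ ^ 3|
        = |iteratedDeriv 1 g (α θ) * iteratedDeriv 3 α θ + 3 * iteratedDeriv 2 g (α θ) * iteratedDeriv 1 α θ * iteratedDeriv 2 α θ| := by ring_nf
      _ ≤ |iteratedDeriv 1 g (α θ) * iteratedDeriv 3 α θ| + |3 * iteratedDeriv 2 g (α θ) * iteratedDeriv 1 α θ * iteratedDeriv 2 α θ| := abs_add_le _ _
      _ ≤ a 1 * X3 + a 2 * (3 * X1 * X2) := by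
          rw [abs_mul, show |3 * iteratedDeriv 2 g (α θ) * iteratedDeriv 1 α θ * iteratedDeriv 2 α θ| =
            |iteratedDeriv 2 g (α θ)| * (3 * X1 * X2) by rw [abs_mul, abs_mul, abs_mul]; simp [X1, X2]; ring]
          gcongr
  · rw [iteratedDeriv_comp_four_of_isOpen hU hg hα hθ]
    have e : Finset.Ico 1 4 = {1, 2, 3} := by decide
    rw [e, Finset.sum_insert (by decide), Finset.sum_pair (show (2 : ℕ) ≠ 3 by norm_num)]
    simp only [bellP]
    calc |iteratedDeriv 4 g (α θ) * iteratedDeriv 1 α θ ^ 4 + 6 * iteratedDeriv 3 g (α θ) * iteratedDeriv 1 α θ ^ 2 * iteratedDeriv 2 α θ +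
            iteratedDeriv 2 g (α θ) * (3 * iteratedDeriv 2 α θ ^ 2 + 4 * iteratedDeriv 1 α θ * iteratedDeriv 3 α θ) +
            iteratedDeriv 1 g (α θ) * iteratedDeriv 4 α θ - iteratedDeriv 4 g (α θ) * iteratedDeriv 1 α θ ^ 4|
        = |iteratedDeriv 1 g (α θ) * iteratedDeriv 4 α θ +
            (iteratedDeriv 2 g (α θ) * (3 * iteratedDeriv 2 α θ ^ 2 + 4 * iteratedDeriv 1 α θ * iteratedDeriv 3 α θ) +
              6 * iteratedDeriv 3 g (α θ) * iteratedDeriv 1 α θ ^ 2 * iteratedDeriv 2 α θ)| := by ring_nf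
      _ ≤ |iteratedDeriv 1 g (α θ) * iteratedDeriv 4 α θ| +
            (|iteratedDeriv 2 g (α θ) * (3 * iteratedDeriv 2 α θ ^ 2 + 4 * iteratedDeriv 1 α θ * iteratedDeriv 3 α θ)| +
              |6 * iteratedDeriv 3 g (α θ) * iteratedDeriv 1 α θ ^ 2 * iteratedDeriv 2 α θ|) :=
          (abs_add_le _ _).trans (add_le_add le_rfl (abs_add_le _ _))
      _ ≤ a 1 * X4 + (a 2 * (3 * X2 ^ 2 + 4 * X1 * X3) + a 3 * (6 * X1 ^ 2 * X2)) := by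
          have e1 : |iteratedDeriv 1 g (α θ) * iteratedDeriv 4 α θ| = |iteratedDeriv 1 g (α θ)| * X4 := abs_mul _ _
          have e2 : |iteratedDeriv 2 g (α θ) * (3 * iteratedDeriv 2 α θ ^ 2 + 4 * iteratedDeriv 1 α θ * iteratedDeriv 3 α θ)| ≤
              |iteratedDeriv 2 g (α θ)| * (3 * X2 ^ 2 + 4 * X1 * X3) := by
            rw [abs_mul]
            refine mul_le_mul_of_nonneg_left ((abs_add_le _ _).trans ?_) (abs_nonneg _)
            rw [abs_mul, abs_mul, abs_mul, abs_pow]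
            simp [X1, X2, X3]
          have e3 : |6 * iteratedDeriv 3 g (α θ) * iteratedDeriv 1 α θ ^ 2 * iteratedDeriv 2 α θ| = |iteratedDeriv 3 g (α θ)| * (6 * X1 ^ 2 * X2) := by
            rw [abs_mul, abs_mul, abs_mul, abs_pow]; simp [X1, X2]; ring
          rw [e1, e3]
          gcongr
          · exact e2.trans (mul_le_mul_of_nonneg_right a2 (by positivity))

/-- **Graded form**: `|∂ᵏ(g∘α)(θ)| ≤ Σ_{1 ≤ l ≤ k} a_l·P_{k,l}(|α′(θ)|,…)` (`1 ≤ k ≤ 4`). -/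
theorem abs_iteratedDeriv_comp_le_bellP {k : ℕ} (hk1 : 1 ≤ k) (hk : k ≤ 4) :
    |iteratedDeriv k (fun x => g (α x)) θ| ≤ ∑ l ∈ Finset.Icc 1 k, a l * bellP k l (fun m => |iteratedDeriv m α θ|) := by
  have h := abs_iteratedDeriv_comp_sub_le_bellP hU hg hα hθ ha hk1 hk
  have hak := ha k hk1 hk (α θ)
  have htop : |iteratedDeriv k g (α θ) * iteratedDeriv 1 α θ ^ k| ≤ a k * bellP k k (fun m => |iteratedDeriv m α θ|) := by
    rw [abs_mul, abs_pow]
    have hb : bellP k k (fun m => |iteratedDeriv m α θ|) = |iteratedDeriv 1 α θ| ^ k := by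
      interval_cases k <;> simp [bellP]
    rw [hb]
    exact mul_le_mul_of_nonneg_right hak (by positivity)
  have hsplit : ∑ l ∈ Finset.Icc 1 k, a l * bellP k l (fun m => |iteratedDeriv m α θ|) =
      (∑ l ∈ Finset.Ico 1 k, a l * bellP k l (fun m => |iteratedDeriv m α θ|)) + a k * bellP k k (fun m => |iteratedDeriv m α θ|) := by
    rw [← Finset.sum_Ico_succ_top hk1]
    rfl
  rw [hsplit]
  calc |iteratedDeriv k (fun x => g (α x)) θ|
      = |(iteratedDeriv k (fun x => g (α x)) θ - iteratedDeriv k g (α θ) * iteratedDeriv 1 α θ ^ k) +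
          iteratedDeriv k g (α θ) * iteratedDeriv 1 α θ ^ k| := by ring_nf
    _ ≤ _ := (abs_add_le _ _).trans (add_le_add h htop)

/-- **Transport against a reference value**: for any `t`,
`|∂ᵏ(g∘α)(θ) − g^{(k)}(t)| ≤ Σ_{l<k} a_l P_{k,l} + a_k·|α′(θ)ᵏ − 1| + |g^{(k)}(α θ) − g^{(k)}(t)|` (`1 ≤ k ≤ 4`). -/
theorem abs_iteratedDeriv_comp_sub_ref_le {k : ℕ} (hk1 : 1 ≤ k) (hk : k ≤ 4) (t : ℝ) :
    |iteratedDeriv k (fun x => g (α x)) θ - iteratedDeriv k g t| ≤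
      (∑ l ∈ Finset.Ico 1 k, a l * bellP k l (fun m => |iteratedDeriv m α θ|)) + a k * |iteratedDeriv 1 α θ ^ k - 1| +
        |iteratedDeriv k g (α θ) - iteratedDeriv k g t| := by
  have h := abs_iteratedDeriv_comp_sub_le_bellP hU hg hα hθ ha hk1 hk
  have hak := ha k hk1 hk (α θ)
  have e : iteratedDeriv k (fun x => g (α x)) θ - iteratedDeriv k g t =
      (iteratedDeriv k (fun x => g (α x)) θ - iteratedDeriv k g (α θ) * iteratedDeriv 1 α θ ^ k) +
        iteratedDeriv k g (α θ) * (iteratedDeriv 1 α θ ^ k - 1) + (iteratedDeriv k g (α θ) - iteratedDeriv k g t) := by ring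
  rw [e]
  refine (abs_add_le _ _).trans (add_le_add ((abs_add_le _ _).trans (add_le_add h ?_)) le_rfl)
  rw [abs_mul]
  exact mul_le_mul_of_nonneg_right hak (abs_nonneg _)

end Bell

/-! ## §3 Periodic profiles: the circle distance controls increments of the jets -/

section Periodic

variable {g : ℝ → ℝ}

/-- The jets of a `2π`-periodic function are `2π`-periodic. -/
theorem iteratedDeriv_periodic (hper : Function.Periodic g (2 * π)) (k : ℕ) : Function.Periodic (iteratedDeriv k g) (2 * π) := by
  intro x
  have h := congrFun (iteratedDeriv_comp_add_const (n := k) (f := g) (s := 2 * π)) x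
  have hfun : (fun z => g (z + 2 * π)) = g := funext hper
  rw [hfun] at h
  exact h.symm

/-- **Increment of a periodic jet by the circle distance**: if `g ∈ C^{k+1}` is `2π`-periodic with `|g^{(k+1)}| ≤ b`, then
`|g^{(k)}(x) − g^{(k)}(t)| ≤ b·|⟨x − t⟩|` with `⟨·⟩ = toIocMod 2π (−π)` the representative in `(−π, π]`. -/
theorem abs_iteratedDeriv_sub_le_of_periodic {k : ℕ} (hg : ContDiff ℝ (k + 1 : ℕ) g) (hper : Function.Periodic g (2 * π)) {b : ℝ}
    (hb : ∀ x, |iteratedDeriv (k + 1) g x| ≤ b) (x t : ℝ) :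
    |iteratedDeriv k g x - iteratedDeriv k g t| ≤ b * |toIocMod Real.two_pi_pos (-π) (x - t)| := by
  set ρ := toIocMod Real.two_pi_pos (-π) (x - t) with hρ
  -- `x = t + ρ + n·2π`
  obtain ⟨n, hn⟩ : ∃ n : ℤ, x - t = ρ + n • (2 * π) :=
    ⟨toIocDiv Real.two_pi_pos (-π) (x - t), (toIocMod_add_toIocDiv_zsmul Real.two_pi_pos (-π) (x - t)).symm⟩
  have hperk := iteratedDeriv_periodic hper k
  have hx : iteratedDeriv k g x = iteratedDeriv k g (t + ρ) := by
    have : x = t + ρ + n • (2 * π) := by linarith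
    rw [this]
    exact hperk.zsmul n _
  rw [hx]
  -- mean value inequality for `iteratedDeriv k g` with derivative bound `b`
  have hdiff : Differentiable ℝ (iteratedDeriv k g) := hg.differentiable_iteratedDeriv k (by exact_mod_cast Nat.lt_succ_self k)
  have hderiv : ∀ y, ‖deriv (iteratedDeriv k g) y‖ ≤ b := fun y => by
    rw [← iteratedDeriv_succ, Real.norm_eq_abs]; exact hb y
  have hmv := Convex.norm_image_sub_le_of_norm_deriv_le (fun y _ => hdiff y) (fun y _ => hderiv y) convex_univ (Set.mem_univ t)
    (Set.mem_univ (t + ρ))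
  rw [Real.norm_eq_abs, Real.norm_eq_abs, add_sub_cancel_left] at hmv
  exact hmv

end Periodic

end Summit.HubbardSuperconductivity.HubbardSuperconductivity.Theorems.KLRegimeSplit

end
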